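import Literature.NumberTheory.Transcendental.ChudnovskyHeights
import Mathlib.Algebra.MvPolynomial.PDeriv
import Mathlib.Algebra.MvPolynomial.Derivation
import Mathlib.RingTheory.IntegralClosure.IsIntegralClosure.Basic
import HarnessLib

/-!
# Arithmetic of polynomial derivations: sizes and denominators of coefficients

Topic: `Literature/NumberTheory/Transcendental`. Plan item W4/S2 (generic half) of the unit
`provefact-Literature.NumberTheory.Transcendental.H-b596640137`. In Baker's method the numbers fed
to Siegel's lemma and to the Liouville inequality are values `(D_{ω₁}∘⋯∘D_{ω_k} H)(g)` of iterated
polynomial derivations (`PolyODEJets.lean`, `LineJetForms.lean`) at algebraic points. This file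
provides the bookkeeping, for polynomials `F ∈ K[ι]` over a field `K` with an embedding
`σ : K →+* ℂ` (a conjugate):

* sizes are measured by the weighted `ℓ¹`-norm `Chudnovsky.wnorm ν` of `ChudnovskyHeights.lean`
  (`ν : RingSeminorm K`; for a conjugate take the pullback `ArithPoly.embSeminorm σ`,
  `a ↦ |σ a|`), whose basic API (monomials, `+`, `*`, powers, evaluation `norm_eval₂_le`) is
  reused from there; NEW here: `ArithPoly.sum_wnorm_pderiv_le` — `∑_i ‖∂_i F‖ ≤ N ‖F‖` for
  `deg F ≤ N` — hence for the derivation `D_Q = ∑_i (∂_i ·) Q_i`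
  (`mkDerivation_apply_eq_sum_mul`): `‖D_Q F‖ ≤ N · q · ‖F‖` (`wnorm_mkDerivation_le`) and
  `deg D_Q F ≤ deg F + e` when `deg Q_i ≤ e` (`totalDegree_mkDerivation_le`);
* `ArithPoly.IsDenInt d e F` — "`d^e · F` has algebraic-integer coefficients": stable under
  `+`, `*` (exponents add), `∂_i`, `D_Q` (exponent `+ e_Q`), and giving
  `d^{e+N} F(g) ∈ 𝓞` at points with `d·gᵢ` integral (`IsDenInt.isIntegral_eval`). (Bookkeeping
  only: for `d = 0`, `e ≥ 1` the predicate holds for every `F`, so users carry `d ≠ 0`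
  separately.)

Everything is proved; sources: Baker 1975 Ch. 2 §3 (the pattern "f' is an algebraic integer of
size …"), Baker–Wüstholz 2007 §6.7–6.8, folklore.

## References

* A. Baker, *Transcendental Number Theory*, CUP 1975, Ch. 2, Lemma 3.
* A. Baker, G. Wüstholz, *Logarithmic Forms and Diophantine Geometry*, CUP 2007, §6.8.
-/

noncomputable section

open MvPolynomial Finset
open Literature.NumberTheory.Transcendental.Chudnovsky

namespace Literature.NumberTheory.Transcendental

namespace ArithPoly

variable {K : Type*} [Field K] {ι : Type*} (ν : RingSeminorm K)

/-! ### The pullback seminorm of a conjugate -/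

/-- The ring seminorm `a ↦ |σ a|` on `K` pulled back along an embedding `σ : K →+* ℂ`.
[folklore] -/
def embSeminorm (σ : K →+* ℂ) : RingSeminorm K where
  toFun a := ‖σ a‖
  map_zero' := by simp
  add_le' a b := by simpa [map_add] using norm_add_le (σ a) (σ b)
  neg' a := by simp
  mul_le' a b := by simp [map_mul]

/-- `embSeminorm σ a = |σ a|`. [folklore] -/
@[simp] theorem embSeminorm_apply (σ : K →+* ℂ) (a : K) : embSeminorm σ a = ‖σ a‖ := rfl

/-- `embSeminorm σ 1 = 1`. [folklore] -/
theorem embSeminorm_one (σ : K →+* ℂ) : embSeminorm σ 1 = 1 := by simp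

/-- A ring seminorm with `ν 1 ≤ 1` is at most `n` on the natural number `n`. [folklore] -/
theorem seminorm_natCast_le {ν : RingSeminorm K} (h1 : ν 1 ≤ 1) (n : ℕ) : ν (n : K) ≤ n := by
  induction n with
  | zero => simp
  | succ n ih =>
    rw [Nat.cast_succ]
    refine (map_add_le_add ν _ _).trans ?_
    push_cast
    linarith

/-! ### Partial derivatives and derivations -/

/-- **`∑_i ‖∂_i F‖ ≤ N · ‖F‖`** for `deg F ≤ N` and a seminorm with `ν 1 ≤ 1` (a monomial of
degree `≤ N` contributes its total exponent). [folklore] -/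
theorem sum_wnorm_pderiv_le [Fintype ι] (h1 : ν 1 ≤ 1) {F : MvPolynomial ι K} {N : ℕ}
    (hN : F.totalDegree ≤ N) :
    ∑ i, wnorm ν (pderiv i F) ≤ N * wnorm ν F := by
  classical
  -- `∂_i F = ∑_μ monomial (μ - eᵢ) (μᵢ • f_μ)`
  have e : ∀ i, pderiv i F = ∑ μ ∈ F.support, monomial (μ - Finsupp.single i 1) (coeff μ F * (μ i)) := by
    intro i
    conv_lhs => rw [F.as_sum]
    rw [map_sum]
    refine sum_congr rfl fun μ _ => ?_
    rw [pderiv_monomial]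
  calc ∑ i, wnorm ν (pderiv i F)
      ≤ ∑ i, ∑ μ ∈ F.support, ν (coeff μ F) * (μ i) := by
        refine sum_le_sum fun i _ => ?_
        rw [e i]
        refine (wnorm_sum_le ν _ _).trans (sum_le_sum fun μ _ => ?_)
        rw [wnorm_monomial]
        exact (map_mul_le_mul ν _ _).trans
          (mul_le_mul_of_nonneg_left (seminorm_natCast_le h1 _) (apply_nonneg ν _))
    _ = ∑ μ ∈ F.support, ν (coeff μ F) * (μ.sum fun _ k => k : ℕ) := by
        rw [sum_comm]
        refine sum_congr rfl fun μ _ => ?_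
        rw [← mul_sum, Finsupp.sum_fintype _ _ (fun _ => rfl)]
        push_cast
        rfl
    _ ≤ ∑ μ ∈ F.support, ν (coeff μ F) * N := by
        refine sum_le_sum fun μ hμ => mul_le_mul_of_nonneg_left ?_ (apply_nonneg ν _)
        exact_mod_cast (le_totalDegree hμ).trans hN
    _ = N * wnorm ν F := by rw [← sum_mul, wnorm, mul_comm]

/-- Removing one from an exponent does not increase the degree. [folklore] -/
theorem degree_tsub_single_le (s : ι →₀ ℕ) (i : ι) :
    ((s - Finsupp.single i 1).sum fun _ => id) ≤ s.sum fun _ => id := by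
  classical
  rw [Finsupp.sum_of_support_subset (s - Finsupp.single i 1) Finsupp.support_tsub _ (fun _ _ => rfl),
    Finsupp.sum]
  exact sum_le_sum fun j _ => tsub_le_self

/-- The total degree does not increase under `∂_i`. [folklore] -/
theorem totalDegree_pderiv_le (i : ι) (F : MvPolynomial ι K) :
    (pderiv i F).totalDegree ≤ F.totalDegree := by
  classical
  conv_lhs => rw [F.as_sum]
  rw [map_sum]
  refine (totalDegree_finsetSum _ _).trans (Finset.sup_le fun μ hμ => ?_)
  rw [pderiv_monomial]
  exact (totalDegree_monomial_le _ _).trans ((degree_tsub_single_le μ i).trans (le_totalDegree hμ))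

/-- **A derivation is `∑_i Q_i ∂_i`**: `D_Q F = ∑_i (∂_i F) · Q_i` for the derivation with
`D_Q(X_i) = Q_i` on a polynomial ring in finitely many variables (the `*`-form; the `•`-form for
derivations into modules is `mkDerivation_apply_eq_sum` of `DerivationExtension.lean`, whose
imports — Kähler differentials — are too heavy for this arithmetic file, hence the separate
elementary proof under a distinct name). [folklore] -/
theorem mkDerivation_apply_eq_sum_mul [Fintype ι] (Q : ι → MvPolynomial ι K) (F : MvPolynomial ι K) :
    mkDerivation K Q F = ∑ i, pderiv i F * Q i := by
  classical
  have hD : mkDerivation K Q =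
      ∑ i, Q i • (pderiv i : Derivation K (MvPolynomial ι K) (MvPolynomial ι K)) := by
    refine derivation_ext fun j => ?_
    rw [mkDerivation_X, ← Derivation.coeFnAddMonoidHom_apply, map_sum, Finset.sum_apply]
    simp only [Derivation.coeFnAddMonoidHom_apply, Derivation.coe_smul, Pi.smul_apply, smul_eq_mul]
    rw [Finset.sum_eq_single j]
    · simp
    · intro i _ hij; simp [pderiv_X_of_ne (Ne.symm hij)]
    · intro h; exact absurd (mem_univ j) h
  rw [hD, ← Derivation.coeFnAddMonoidHom_apply, map_sum, Finset.sum_apply]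
  simp only [Derivation.coeFnAddMonoidHom_apply, Derivation.coe_smul, Pi.smul_apply, smul_eq_mul]
  exact sum_congr rfl fun i _ => mul_comm _ _

/-- **Size of a derivation**: if `deg F ≤ N`, `ν 1 ≤ 1` and `‖Q_i‖ ≤ q` (`q ≥ 0`) for all `i`
then `‖D_Q F‖ ≤ N·q·‖F‖`. [folklore] -/
theorem wnorm_mkDerivation_le [Fintype ι] (h1 : ν 1 ≤ 1) {Q : ι → MvPolynomial ι K} {q : ℝ}
    (hq0 : 0 ≤ q) (hq : ∀ i, wnorm ν (Q i) ≤ q) {F : MvPolynomial ι K} {N : ℕ}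
    (hN : F.totalDegree ≤ N) :
    wnorm ν (mkDerivation K Q F) ≤ N * q * wnorm ν F := by
  rw [mkDerivation_apply_eq_sum_mul]
  calc wnorm ν (∑ i, pderiv i F * Q i)
      ≤ ∑ i, wnorm ν (pderiv i F) * q := by
        refine (wnorm_sum_le ν _ _).trans (sum_le_sum fun i _ => ?_)
        exact (wnorm_mul_le ν _ _).trans
          (mul_le_mul_of_nonneg_left (hq i) (wnorm_nonneg ν _))
    _ = (∑ i, wnorm ν (pderiv i F)) * q := by rw [sum_mul]
    _ ≤ N * wnorm ν F * q := mul_le_mul_of_nonneg_right (sum_wnorm_pderiv_le ν h1 hN) hq0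
    _ = N * q * wnorm ν F := by ring

/-- **Degree of a derivation**: if `deg Q_i ≤ e` then `deg D_Q F ≤ deg F + e`. [folklore] -/
theorem totalDegree_mkDerivation_le [Fintype ι] {Q : ι → MvPolynomial ι K} {e : ℕ}
    (hQ : ∀ i, (Q i).totalDegree ≤ e) (F : MvPolynomial ι K) :
    (mkDerivation K Q F).totalDegree ≤ F.totalDegree + e := by
  rw [mkDerivation_apply_eq_sum_mul]
  refine (totalDegree_finsetSum _ _).trans (Finset.sup_le fun i _ => ?_)
  exact (totalDegree_mul _ _).trans (add_le_add (totalDegree_pderiv_le i F) (hQ i))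

/-! ### Denominators -/

/-- **`d^e · F` has algebraic-integer coefficients.** [folklore] -/
def IsDenInt (d : ℤ) (e : ℕ) (F : MvPolynomial ι K) : Prop :=
  ∀ μ, IsIntegral ℤ ((d : K) ^ e * coeff μ F)

namespace IsDenInt

variable {σ} {d : ℤ} {e e' : ℕ} {F G : MvPolynomial ι K}

/-- The defining property, coefficientwise. [folklore] -/
theorem coeff (h : IsDenInt d e F) (μ : ι →₀ ℕ) : IsIntegral ℤ ((d : K) ^ e * MvPolynomial.coeff μ F) :=
  h μ

/-- `0`. [folklore] -/
theorem zero : IsDenInt d e (0 : MvPolynomial ι K) := fun μ => by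
  simpa using isIntegral_zero

/-- Sums. [folklore] -/
theorem add (hF : IsDenInt d e F) (hG : IsDenInt d e G) : IsDenInt d e (F + G) := fun μ => by
  rw [coeff_add, mul_add]; exact (hF.coeff μ).add (hG.coeff μ)

/-- Negation. [folklore] -/
theorem neg (hF : IsDenInt d e F) : IsDenInt d e (-F) := fun μ => by
  rw [coeff_neg, mul_neg]; exact (hF.coeff μ).neg

/-- Differences. [folklore] -/
theorem sub (hF : IsDenInt d e F) (hG : IsDenInt d e G) : IsDenInt d e (F - G) := by
  rw [sub_eq_add_neg]; exact hF.add hG.neg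

/-- Finite sums. [folklore] -/
theorem sum {α : Type*} {s : Finset α} {F : α → MvPolynomial ι K} (h : ∀ a ∈ s, IsDenInt d e (F a)) :
    IsDenInt d e (∑ a ∈ s, F a) := by
  classical
  induction s using Finset.induction_on with
  | empty => simpa using (zero : IsDenInt d e (0 : MvPolynomial ι K))
  | insert a s ha ih =>
    rw [sum_insert ha]
    exact (h a (mem_insert_self a s)).add (ih fun b hb => h b (mem_insert_of_mem hb))

/-- Raising the exponent. [folklore] -/
theorem mono (hF : IsDenInt d e F) (he : e ≤ e') : IsDenInt d e' F := fun μ => by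
  rw [← Nat.sub_add_cancel he, pow_add, mul_assoc]
  exact ((isIntegral_intCast (B := K) d).pow _).mul (hF.coeff μ)

/-- Monomials. [folklore] -/
theorem monomial {μ : ι →₀ ℕ} {a : K} (ha : IsIntegral ℤ ((d : K) ^ e * a)) :
    IsDenInt d e (MvPolynomial.monomial μ a) := fun ν => by
  classical
  rw [coeff_monomial]
  split_ifs
  · exact ha
  · simpa using isIntegral_zero

/-- Constants. [folklore] -/
theorem C {a : K} (ha : IsIntegral ℤ ((d : K) ^ e * a)) : IsDenInt d e (MvPolynomial.C a : MvPolynomial ι K) := by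
  rw [← monomial_zero']; exact monomial ha

/-- Variables (no denominator). [folklore] -/
theorem X (i : ι) : IsDenInt d 0 (MvPolynomial.X i : MvPolynomial ι K) := by
  refine monomial ?_
  simpa using isIntegral_one

/-- Products: exponents add. [folklore] -/
theorem mul (hF : IsDenInt d e F) (hG : IsDenInt d e' G) : IsDenInt d (e + e') (F * G) := fun μ => by
  classical
  rw [coeff_mul, mul_sum]
  refine IsIntegral.sum _ fun x _ => ?_
  have : (d : K) ^ (e + e') * (MvPolynomial.coeff x.1 F * MvPolynomial.coeff x.2 G) =
      ((d : K) ^ e * MvPolynomial.coeff x.1 F) * ((d : K) ^ e' * MvPolynomial.coeff x.2 G) := by rw [pow_add]; ring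
  rw [this]
  exact (hF.coeff _).mul (hG.coeff _)

/-- Powers. [folklore] -/
theorem pow (hF : IsDenInt d e F) (n : ℕ) : IsDenInt d (n * e) (F ^ n) := by
  induction n with
  | zero => intro μ; classical
            rw [pow_zero, zero_mul, pow_zero, one_mul, coeff_one]
            split_ifs <;> simp [isIntegral_one, isIntegral_zero]
  | succ n ih => rw [pow_succ, Nat.succ_mul]; exact ih.mul hF

/-- Partial derivatives keep the denominator. [folklore] -/
theorem pderiv (hF : IsDenInt d e F) (i : ι) : IsDenInt d e (MvPolynomial.pderiv i F) := fun μ => by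
  rw [coeff_pderiv, ← mul_assoc]
  have h1 : IsIntegral ℤ ((μ i : K) + 1) := by
    have := (isIntegral_intCast (B := K) (μ i : ℤ)).add isIntegral_one
    simpa using this
  exact (hF.coeff (μ + Finsupp.single i 1)).mul h1

/-- **Derivations**: if `d^e F` and all `d^{e_Q} Q_i` are integral then so is
`d^{e+e_Q} D_Q F`. [folklore] -/
theorem mkDerivation [Fintype ι] {Q : ι → MvPolynomial ι K} {eQ : ℕ} (hQ : ∀ i, IsDenInt d eQ (Q i))
    (hF : IsDenInt d e F) : IsDenInt d (e + eQ) (MvPolynomial.mkDerivation K Q F) := by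
  rw [mkDerivation_apply_eq_sum_mul]
  exact sum fun i _ => (hF.pderiv i).mul (hQ i)

/-- **Values at points with denominator `d`**: if `d^e F` is integral, `deg F ≤ N` and all
`d·gᵢ` are integral then `d^{e+N}·F(g)` is an algebraic integer. [folklore] -/
theorem isIntegral_eval [Fintype ι] (hF : IsDenInt d e F) {N : ℕ} (hN : F.totalDegree ≤ N) {g : ι → K}
    (hg : ∀ i, IsIntegral ℤ ((d : K) * g i)) :
    IsIntegral ℤ ((d : K) ^ (e + N) * eval g F) := by
  classical
  conv => rw [F.as_sum]
  rw [map_sum, mul_sum]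
  refine IsIntegral.sum _ fun μ hμ => ?_
  rw [eval_monomial]
  have hdeg : μ.sum (fun _ k => k) ≤ N := (le_totalDegree hμ).trans hN
  have hdeg' : ∑ i ∈ μ.support, μ i ≤ N := by simpa [Finsupp.sum] using hdeg
  have e1 : (d : K) ^ (e + N) * (MvPolynomial.coeff μ F * μ.prod fun i k => g i ^ k) =
      ((d : K) ^ e * MvPolynomial.coeff μ F) * ((d : K) ^ (N - ∑ i ∈ μ.support, μ i) *
        ∏ i ∈ μ.support, ((d : K) * g i) ^ μ i) := by
    rw [Finsupp.prod, prod_congr rfl (fun i _ => mul_pow (d : K) (g i) (μ i)), prod_mul_distrib,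
      prod_pow_eq_pow_sum, pow_add]
    conv_rhs => rw [show (d : K) ^ e * MvPolynomial.coeff μ F * ((d : K) ^ (N - ∑ i ∈ μ.support, μ i) *
        ((d : K) ^ (∑ i ∈ μ.support, μ i) * ∏ i ∈ μ.support, g i ^ μ i)) =
        (d : K) ^ e * ((d : K) ^ (N - ∑ i ∈ μ.support, μ i) * (d : K) ^ (∑ i ∈ μ.support, μ i)) *
          (MvPolynomial.coeff μ F * ∏ i ∈ μ.support, g i ^ μ i) by ring, ← pow_add, Nat.sub_add_cancel hdeg']
  rw [e1]
  exact (hF.coeff μ).mul (((isIntegral_intCast (B := K) d).pow _).mul (IsIntegral.prod _ fun i _ => (hg i).pow _))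

end IsDenInt

/-! ### Sizes of values -/

/-- **`|σ(F(g))| ≤ ‖F‖_σ · M^{deg F}`** if `|σ gᵢ| ≤ M`, `M ≥ 1` (the case `ν = embSeminorm σ`,
`φ = σ` of `Chudnovsky.norm_eval₂_le`). [folklore] -/
theorem norm_embedding_eval_le (σ : K →+* ℂ) (F : MvPolynomial ι K) (g : ι → K) {M : ℝ} (hM : 1 ≤ M)
    (hg : ∀ i, ‖σ (g i)‖ ≤ M) :
    ‖σ (eval g F)‖ ≤ wnorm (embSeminorm σ) F * M ^ F.totalDegree := by
  have h := norm_eval₂_le (embSeminorm σ) σ (fun a => le_rfl) F (fun i => σ (g i)) hM hg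
  have e : σ (eval g F) = eval₂ σ (fun i => σ (g i)) F := by
    simp [MvPolynomial.eval_eq, MvPolynomial.eval₂_eq, map_sum, map_mul, map_prod, map_pow]
  rwa [← e] at h

end ArithPoly

end Literature.NumberTheory.Transcendental

end
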